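import Literature.Analysis.FluidPDE.ChaeAsymptoticallySelfSimilarLimit
import Literature.Analysis.FluidPDE.ChaeAsymptoticallySelfSimilarEndgame
import Literature.Analysis.FluidPDE.NecasRuzickaSverakHolds
import Literature.Analysis.FluidPDE.TsaiSelfSimilarHolds
import HarnessLib

/-!
# Chae 2007, Theorem 1.5: assembly of the printed proof from its two remaining inputs
# (proofs companion, part 4)

Analysis/FluidPDE proofs file (theorems only: no definitions, no named facts), fourth companion of
`Literature/Analysis/FluidPDE/ChaeAsymptoticallySelfSimilar.lean` (D. Chae, *Nonexistence of
asymptotically self-similar singularities in the Euler and the Navier–Stokes equations*, Math.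
Ann. 338 (2007) 435–449 = arXiv:math/0604234, **Theorem 1.5**, the named fact
`chae2007_asymptoticallySelfSimilar_local`). The companions formalise the printed proof
(arXiv pp. 7–8):

1. `ChaeAsymptoticallySelfSimilarProofs.lean` — the radius claim (3.9)–(3.12) and the similarity
   variables (3.13)–(3.14): the hypothesis in normal form is the convergence of the blow-up
   rescalings `v_λ → u_V̄ = lerayBackward ½ 0 V̄` in `L^∞((−1,0); L^q(B_R))`, every `R`;
2. `ChaeAsymptoticallySelfSimilarLimit.lean` — "we can pass to the limit in the weak formulation …
   `V̄` is a weak solution of the Leray system (3.6)": `V̄ ∈ L^q_{loc}` is weakly divergence free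
   and a very weak solution of Leray's profile system;
3. `ChaeAsymptoticallySelfSimilarEndgame.lean` — "the conclusion follows from Theorem 3.1": the
   ε-regularity lemma with Hölder conclusion up to the top (`ess_epsilon_regularity'_holds`) turned
   into Hölder continuity of `v` on `Q((T, z), r₀/2)`.

This file PROVES `chae2007_profile_ae_eq_zero_of_regularityInput` (the first conclusion `V̄ = 0`
from the first input alone) and `chae2007_asymptoticallySelfSimilar_local_of_inputs` (with the
primed variant over ESS's class): **Theorem 1.5 follows from two analytic inputs**, stated as
explicit hypotheses (the paper takes both from the literature;
neither is a theorem of the tree yet, and no named fact is introduced for them here):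

* `h₁`, *regularity of very weak Leray profiles*: a weakly divergence-free `V ∈ L^p(ℝ³)`,
  `3 ≤ p < ∞`, solving Leray's system against divergence-free test fields agrees a.e. with a `C²`
  profile of `IsLerayProfile 1 ½` — the class of the tree's proved Liouville theorems
  `necas_ruzicka_sverak_holds` (`p = 3`) and `tsai_selfsimilar_holds` (`p > 3`) (NRŠ 1996, p. 287
  and Tsai 1998, p. 33 assert the smoothness of *weak* solutions; the very weak case is the
  standard interior regularity theory of the stationary system);
* `h₂`, *suitability up to the blow-up time and smallness at one scale*: for the Kato-class
  classical solution and `q ≥ 2`, the vanishing (3.15) of Chae's deviation from the zero profile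
  for all `R` yields, for every `ε > 0`, a scale `r₀` and a suitable pair `(u, p)` in the
  parabolic ball `Q((T, z), r₀)` hanging from the final time (`IsSuitableWeakSolutionInBall`,
  Albritton–Barker's class) with `u = v` a.e. there and `C(r₀) + D(r₀) < ε` — or, in the primed
  variant, a pressure `P` with `(r₀ v(T + r₀²·, z + r₀·), P)` ESS-suitable on `B₁ × (−1, 0)` and
  `∫∫_{Q₁}(|U|³ + |P|^{3/2}) < ε` (Chae's Thm 3.1 presupposes "a suitable weak solution of (NS) in
  a cylinder `B(z, r₁) × (t − r₁², t)`"; for `v ∈ C([0,T); L^p)` this is local Leray theory up to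
  `T` — cf. the tree's facts `localEnergySolution_exists_local_of_memE2`,
  `localEnergySolution_extension_of_memE2`, `local_leray_weak_strong_uniqueness` — followed by
  the passage from (3.16) to the one-scale smallness, Gustafson–Kang–Tsai 2007, Thm 1.1).

and the glue `chaeLocalDeviation_congr_ae` (a.e.-equal profiles have equal deviations). With
`h₁`, `h₂` discharged, `chae2007_asymptoticallySelfSimilar_local_holds` is this theorem applied to
their proofs.

## References

* D. Chae, Math. Ann. 338 (2007) 435–449 = arXiv:math/0604234, Thm 1.5, proof pp. 7–8, Thm 3.1
  [Chae2007].
* J. Nečas, M. Růžička, V. Šverák, Acta Math. 176 (1996) 283–294, Thm 1 [NecasRuzickaSverak1996].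
* T.-P. Tsai, Arch. Rational Mech. Anal. 143 (1998) 29–51, Thm 1 [Tsai1998].
* S. Gustafson, K. Kang, T.-P. Tsai, Comm. Math. Phys. 273 (2007) 161–176, Thm 1.1
  [GustafsonKangTsai2007].
-/

noncomputable section

open _root_.MeasureTheory Set Function Filter Metric TopologicalSpace
open scoped NNReal ENNReal _root_.Topology RealInnerProductSpace Laplacian

namespace Literature.Analysis.FluidPDE

/-! ### Assembly: Theorem 1.5 from the two remaining analytic inputs -/

section Assembly

/-- `chaeLocalDeviation` only sees the profile through integrals: a.e.-equal profiles have the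
same deviation (the comparison fields `x ↦ c • V(c' • (x − z))`, `c' ≠ 0`, are then a.e. equal,
dilations and translations being measure-class preserving). [folklore] -/
theorem chaeLocalDeviation_congr_ae {T : ℝ} {z : EuclideanSpace ℝ (Fin 3)} {q : ℝ≥0} {R : ℝ}
    {v : ℝ → EuclideanSpace ℝ (Fin 3) → EuclideanSpace ℝ (Fin 3)}
    {V V' : EuclideanSpace ℝ (Fin 3) → EuclideanSpace ℝ (Fin 3)} (h : V =ᵐ[volume] V') (t : ℝ) :
    chaeLocalDeviation T z q R v V t = chaeLocalDeviation T z q R v V' t := by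
  rw [chaeLocalDeviation_def, chaeLocalDeviation_def]
  congr 1
  refine iSup_congr fun τ => iSup_congr fun hτ => ?_
  refine eLpNorm_congr_ae (ae_restrict_of_ae ?_)
  set c : ℝ := (Real.sqrt (T - τ))⁻¹ with hc
  have hc0 : c ≠ 0 := inv_ne_zero (Real.sqrt_pos.2 (sub_pos.2 hτ.2)).ne'
  -- the affine map `x ↦ c • (x - z)` is quasi-measure-preserving
  have hqmp : Measure.QuasiMeasurePreserving (fun x : EuclideanSpace ℝ (Fin 3) => c • (x - z))
      volume volume := by
    have h1 : Measure.QuasiMeasurePreserving (fun x : EuclideanSpace ℝ (Fin 3) => x - z) volume volume :=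
      (measurePreserving_sub_right volume z).quasiMeasurePreserving
    exact (Measure.quasiMeasurePreserving_smul volume hc0).comp h1
  have h2 : (fun x => V (c • (x - z))) =ᵐ[volume] fun x => V' (c • (x - z)) := hqmp.ae_eq_comp h
  filter_upwards [h2] with x hx
  simp only [hx]

/-- **First conclusion of Theorem 1.5 from the profile-regularity input** (Chae 2007, proof of
Thm 1.5, arXiv p. 8: "`V̄` is a weak solution of the Leray system … by hypothesis `V̄ ∈ L^p(ℝ³)`
with `p ∈ [3, ∞)`, hence `V̄ = 0` by the results of [NRŠ, Tsai]"). Let `v` be a classical solution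
of Navier–Stokes (`ν = 1`, no force) on `ℝ³ × (0, T)`, `V̄ ∈ L^p(ℝ³)`, `3 ≤ p < ∞`, `q ≥ 2`, and
suppose Chae's deviation tends to zero as `t ↑ T` for every `R > 0` (the hypothesis of Thm 1.5
in normal form, `forall_tendsto_chaeLocalDeviation_of_hyp`). Assume the input `h₁`: every weakly
divergence-free `V ∈ L^p`, `3 ≤ p`, solving Leray's system `−ΔV + ½V + ½(y·∇)V + (V·∇)V + ∇P = 0`
against divergence-free test fields agrees a.e. with a `C²` profile (`IsLerayProfile 1 ½`). Then
`V̄ = 0` a.e.: by the companions `V̄` is such a very weak profile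
(`isWeaklyDivFree_profile_of_tendsto`, `lerayVeryWeak_profile_of_tendsto`), its `C²` representative
lies in `L^p` and vanishes by Nečas–Růžička–Šverák (`p = 3`, `necas_ruzicka_sverak_holds`) or Tsai
(`p > 3`, `tsai_selfsimilar_holds`). No continuity of `v` in `L^p` is needed for this half.
[cite: Chae2007, proof of Thm 1.5 (arXiv p. 8)] -/
theorem chae2007_profile_ae_eq_zero_of_regularityInput
    (h₁ : ∀ (V : EuclideanSpace ℝ (Fin 3) → EuclideanSpace ℝ (Fin 3)) (p : ℝ≥0), 3 ≤ p →
      MemLp V (p : ℝ≥0∞) volume → IsWeaklyDivFree V →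
      (∀ Φ : EuclideanSpace ℝ (Fin 3) → EuclideanSpace ℝ (Fin 3),
        FunctionSpaces.IsTestFunctionOn (⊤ : Opens (EuclideanSpace ℝ (Fin 3))) Φ →
        VectorCalculus.IsDivFree Φ →
        ∫ w, (⟪V w, (Δ Φ) w⟫ + ⟪V w, Φ w⟫ + 1 / 2 * ⟪V w, fderiv ℝ Φ w w⟫ +
          ⟪V w, fderiv ℝ Φ w (V w)⟫) = 0) →
      ∃ (U : EuclideanSpace ℝ (Fin 3) → EuclideanSpace ℝ (Fin 3)) (P : EuclideanSpace ℝ (Fin 3) → ℝ),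
        IsLerayProfile 1 (1 / 2) U P ∧ V =ᵐ[volume] U)
    {T : ℝ} (hT : 0 < T) {p : ℝ≥0} (hp : 3 ≤ p)
    {v : ℝ → EuclideanSpace ℝ (Fin 3) → EuclideanSpace ℝ (Fin 3)}
    {π : ℝ → EuclideanSpace ℝ (Fin 3) → ℝ} (hv : IsClassicalNSSolutionOn (Ioo 0 T) 1 0 v π)
    (z : EuclideanSpace ℝ (Fin 3)) {V : EuclideanSpace ℝ (Fin 3) → EuclideanSpace ℝ (Fin 3)}
    (hV : MemLp V (p : ℝ≥0∞) volume) {q : ℝ≥0} (hq2 : 2 ≤ q)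
    (hall : ∀ R : ℝ, 0 < R → Tendsto (chaeLocalDeviation T z q R v V) (𝓝[<] T) (𝓝 0)) :
    V =ᵐ[volume] 0 := by
  have hlim : ∀ R : ℝ, 0 < R → Tendsto (fun l : ℝ => ⨆ s ∈ Ioo (-1 : ℝ) 0, eLpNorm
      (fun y => nsRescale l (fun τ x => v (T + τ) (z + x)) s y - lerayBackward (1 / 2) 0 V s y)
      (q : ℝ≥0∞) (volume.restrict (ball 0 R))) (𝓝[>] 0) (𝓝 0) := fun R hR =>
    tendsto_iSup_nsRescale_sub_lerayBackward (hall R hR)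
  have hVm : AEStronglyMeasurable V volume := hV.1
  have hdiv := isWeaklyDivFree_profile_of_tendsto hT hv hq2 hVm hlim
  have hleray : ∀ Φ : EuclideanSpace ℝ (Fin 3) → EuclideanSpace ℝ (Fin 3),
      FunctionSpaces.IsTestFunctionOn (⊤ : Opens (EuclideanSpace ℝ (Fin 3))) Φ →
      VectorCalculus.IsDivFree Φ →
      ∫ w, (⟪V w, (Δ Φ) w⟫ + ⟪V w, Φ w⟫ + 1 / 2 * ⟪V w, fderiv ℝ Φ w w⟫ +
        ⟪V w, fderiv ℝ Φ w (V w)⟫) = 0 := fun Φ hΦ hΦdiv =>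
    lerayVeryWeak_profile_of_tendsto hT hv hq2 hVm hlim hΦ hΦdiv
  obtain ⟨U, P, hprof, hVU⟩ := h₁ V p hp hV hdiv hleray
  have hU : MemLp U (p : ℝ≥0∞) volume := hV.ae_eq hVU
  have hU0 : U = 0 := by
    rcases hp.eq_or_lt with h3 | h3
    · have hU3 : MemLp U 3 volume := by
        have : ((p : ℝ≥0) : ℝ≥0∞) = 3 := by rw [← h3]; norm_num
        rwa [this] at hU
      exact necas_ruzicka_sverak_holds one_pos (by norm_num) hprof hU3
    · exact tsai_selfsimilar_holds one_pos (by norm_num) hprof (by exact_mod_cast h3)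
        ENNReal.coe_lt_top hU
  rw [← hU0]
  exact hVU

/-- **Chae 2007, Theorem 1.5, assembled from the two remaining analytic inputs.** The printed
proof (arXiv pp. 7–8) is formalised in the companions up to two inputs which the paper takes from
the literature and which are not yet theorems of the tree; this theorem makes them explicit
hypotheses (no named fact is introduced) and proves `chae2007_asymptoticallySelfSimilar_local`
from them:

* `h₁` — **regularity of very weak Leray profiles** (as in
  `chae2007_profile_ae_eq_zero_of_regularityInput`);
* `h₂` — **suitability up to the blow-up time and smallness at one scale** ("Hence, the
  conclusion follows from Theorem 3.1", p. 8, Theorem 3.1 = Gustafson–Kang–Tsai's criterion for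
  *suitable weak solutions in a cylinder* `B(z, r₁) × (T − r₁², T)`): for the Kato-class classical
  solution `v` and `q ≥ 2`, the vanishing (3.15) of Chae's deviation from the *zero* profile for
  every `R` provides, for every `ε > 0`, a scale `0 < r₀`, `r₀² ≤ T`, and a suitable pair `(u, p)`
  in the parabolic ball `Q((T, z), r₀)` hanging from the final time (`IsSuitableWeakSolutionInBall`)
  with `u = v` a.e. there and `C(r₀) + D(r₀) < ε` (local Leray theory up to the final time, cf.
  the tree's facts `localEnergySolution_exists_local_of_memE2`,
  `localEnergySolution_extension_of_memE2`, `local_leray_weak_strong_uniqueness`, followed by the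
  passage (3.16) ⇒ smallness).

Proof: normal form of the hypothesis ⇒ `V̄ = 0` a.e. by the previous theorem ⇒ the deviation from
the zero profile tends to zero for every `R` (`chaeLocalDeviation_congr_ae`) ⇒ `h₂` supplies the
ε-regularity input at the `ε₀` of `chae_exists_eps_holder_of_suitableInBall`, which yields the
Hölder conclusion. [cite: Chae2007, Thm 1.5 and its proof (arXiv pp. 7–8)] -/
theorem chae2007_asymptoticallySelfSimilar_local_of_inputs
    (h₁ : ∀ (V : EuclideanSpace ℝ (Fin 3) → EuclideanSpace ℝ (Fin 3)) (p : ℝ≥0), 3 ≤ p →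
      MemLp V (p : ℝ≥0∞) volume → IsWeaklyDivFree V →
      (∀ Φ : EuclideanSpace ℝ (Fin 3) → EuclideanSpace ℝ (Fin 3),
        FunctionSpaces.IsTestFunctionOn (⊤ : Opens (EuclideanSpace ℝ (Fin 3))) Φ →
        VectorCalculus.IsDivFree Φ →
        ∫ w, (⟪V w, (Δ Φ) w⟫ + ⟪V w, Φ w⟫ + 1 / 2 * ⟪V w, fderiv ℝ Φ w w⟫ +
          ⟪V w, fderiv ℝ Φ w (V w)⟫) = 0) →
      ∃ (U : EuclideanSpace ℝ (Fin 3) → EuclideanSpace ℝ (Fin 3)) (P : EuclideanSpace ℝ (Fin 3) → ℝ),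
        IsLerayProfile 1 (1 / 2) U P ∧ V =ᵐ[volume] U)
    (h₂ : ∀ ⦃T : ℝ⦄, 0 < T → ∀ ⦃p : ℝ≥0⦄, 3 ≤ p →
      ∀ ⦃v : ℝ → EuclideanSpace ℝ (Fin 3) → EuclideanSpace ℝ (Fin 3)⦄
        ⦃π : ℝ → EuclideanSpace ℝ (Fin 3) → ℝ⦄,
      IsClassicalNSSolutionOn (Ioo 0 T) 1 0 v π → ContinuousInLpOn (Ico 0 T) p v →
      ∀ (z : EuclideanSpace ℝ (Fin 3)) ⦃q : ℝ≥0⦄, 2 ≤ q →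
      (∀ R : ℝ, 0 < R → Tendsto (chaeLocalDeviation T z q R v 0) (𝓝[<] T) (𝓝 0)) →
      ∀ ε : ℝ, 0 < ε → ∃ r₀ : ℝ, 0 < r₀ ∧ r₀ ^ 2 ≤ T ∧
        ∃ (u : ℝ → EuclideanSpace ℝ (Fin 3) → EuclideanSpace ℝ (Fin 3))
          (P : ℝ → EuclideanSpace ℝ (Fin 3) → ℝ),
          IsSuitableWeakSolutionInBall r₀ (T, z) u P ∧
          uncurry u =ᵐ[volume.restrict (parabolicCylinder r₀ (T, z))] uncurry v ∧
          cknC r₀ (T, z) u + cknD r₀ (T, z) P < ENNReal.ofReal ε) :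
    chae2007_asymptoticallySelfSimilar_local := by
  intro T hT p hp v π hv hvc z V hV q hq
  obtain ⟨hq2, hall⟩ := forall_tendsto_chaeLocalDeviation_of_hyp hq
  have hV0 : V =ᵐ[volume] 0 :=
    chae2007_profile_ae_eq_zero_of_regularityInput h₁ hT hp hv z hV hq2 hall
  refine ⟨hV0, ?_⟩
  have hall0 : ∀ R : ℝ, 0 < R → Tendsto (chaeLocalDeviation T z q R v 0) (𝓝[<] T) (𝓝 0) := by
    intro R hR
    refine (hall R hR).congr fun t => ?_
    exact chaeLocalDeviation_congr_ae hV0 t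
  obtain ⟨ε₀, hε₀, H⟩ := chae_exists_eps_holder_of_suitableInBall hv z
  obtain ⟨r₀, hr₀, hr₀T, u, P₀, hsuit, huv, hsmall⟩ := h₂ hT hp hv hvc z hq2 hall0 ε₀ hε₀
  exact H r₀ hr₀ hr₀T u P₀ hsuit huv hsmall

/-- **Variant with the input in Escauriaza–Seregin–Šverák's form**: the same assembly when the
suitability input delivers the zoomed pair `(r₀ v(T + r₀²·, z + r₀·), P)` in the verbatim class
of ESS Def. 2.1 on `B₁ × (−1, 0)` with `∫∫_{Q₁} (|U|³ + |P|^{3/2}) < ε` (the hypothesis class of the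
accepted `ess_epsilon_regularity'`; endgame `chae_exists_eps_holder_of_essSuitable`).
[cite: Chae2007, Thm 1.5 and its proof (arXiv pp. 7–8)] -/
theorem chae2007_asymptoticallySelfSimilar_local_of_inputs'
    (h₁ : ∀ (V : EuclideanSpace ℝ (Fin 3) → EuclideanSpace ℝ (Fin 3)) (p : ℝ≥0), 3 ≤ p →
      MemLp V (p : ℝ≥0∞) volume → IsWeaklyDivFree V →
      (∀ Φ : EuclideanSpace ℝ (Fin 3) → EuclideanSpace ℝ (Fin 3),
        FunctionSpaces.IsTestFunctionOn (⊤ : Opens (EuclideanSpace ℝ (Fin 3))) Φ →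
        VectorCalculus.IsDivFree Φ →
        ∫ w, (⟪V w, (Δ Φ) w⟫ + ⟪V w, Φ w⟫ + 1 / 2 * ⟪V w, fderiv ℝ Φ w w⟫ +
          ⟪V w, fderiv ℝ Φ w (V w)⟫) = 0) →
      ∃ (U : EuclideanSpace ℝ (Fin 3) → EuclideanSpace ℝ (Fin 3)) (P : EuclideanSpace ℝ (Fin 3) → ℝ),
        IsLerayProfile 1 (1 / 2) U P ∧ V =ᵐ[volume] U)
    (h₂ : ∀ ⦃T : ℝ⦄, 0 < T → ∀ ⦃p : ℝ≥0⦄, 3 ≤ p →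
      ∀ ⦃v : ℝ → EuclideanSpace ℝ (Fin 3) → EuclideanSpace ℝ (Fin 3)⦄
        ⦃π : ℝ → EuclideanSpace ℝ (Fin 3) → ℝ⦄,
      IsClassicalNSSolutionOn (Ioo 0 T) 1 0 v π → ContinuousInLpOn (Ico 0 T) p v →
      ∀ (z : EuclideanSpace ℝ (Fin 3)) ⦃q : ℝ≥0⦄, 2 ≤ q →
      (∀ R : ℝ, 0 < R → Tendsto (chaeLocalDeviation T z q R v 0) (𝓝[<] T) (𝓝 0)) →
      ∀ ε : ℝ, 0 < ε → ∃ r₀ : ℝ, 0 < r₀ ∧ r₀ ^ 2 ≤ T ∧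
        ∃ P : ℝ → EuclideanSpace ℝ (Fin 3) → ℝ,
          IsESSSuitablePairOn unitBall (-1) 0 1 (r₀ • stPull (r₀ ^ 2) r₀ T z v) P ∧
          ∫⁻ w in parabolicCylinder 1 ((0 : ℝ), (0 : EuclideanSpace ℝ (Fin 3))),
              (‖(r₀ • stPull (r₀ ^ 2) r₀ T z v) w.1 w.2‖ₑ ^ 3 + ‖P w.1 w.2‖ₑ ^ (3 / 2 : ℝ)) <
            ENNReal.ofReal ε) :
    chae2007_asymptoticallySelfSimilar_local := by
  intro T hT p hp v π hv hvc z V hV q hq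
  obtain ⟨hq2, hall⟩ := forall_tendsto_chaeLocalDeviation_of_hyp hq
  have hV0 : V =ᵐ[volume] 0 :=
    chae2007_profile_ae_eq_zero_of_regularityInput h₁ hT hp hv z hV hq2 hall
  refine ⟨hV0, ?_⟩
  have hall0 : ∀ R : ℝ, 0 < R → Tendsto (chaeLocalDeviation T z q R v 0) (𝓝[<] T) (𝓝 0) := by
    intro R hR
    refine (hall R hR).congr fun t => ?_
    exact chaeLocalDeviation_congr_ae hV0 t
  obtain ⟨ε₀, hε₀, H⟩ := chae_exists_eps_holder_of_essSuitable hv z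
  obtain ⟨r₀, hr₀, hr₀T, P₀, hsuit, hsmall⟩ := h₂ hT hp hv hvc z hq2 hall0 ε₀ hε₀
  exact H r₀ hr₀ hr₀T P₀ hsuit hsmall

end Assembly


end Literature.Analysis.FluidPDE

end
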